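import Summits.QuantumFields.YangMills.Theses.SwapTwistDeficit
import Summits.QuantumFields.YangMills.Theorems.SwapTwistDeficitSheetTrialEstimates
import Summits.QuantumFields.YangMills.Theorems.SwapTwistDeficitEigenDataTraces
import Summits.QuantumFields.YangMills.Theorems.ThermalTraceWindowFewBodyEntropyRungFixedL
import Summits.QuantumFields.YangMills.Theorems.SlowBitWindowJensenDoor
import Summits.QuantumFields.YangMills.Theorems.SwapTwistDeficitCauchySchwarzHelpers
import HarnessLib

/-!
# BC5 rung «r1» of `SwapTwistDeficit.TwistDeficit` (item stmt-QuantumFields-23317) at EVERY FIXED LATTICE SIZE `L ≥ 2` — PROVED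

`TwistDeficit` (crux of route `SwapTwistDeficit`, D-0145 LINE g10-B of seat ym-idea-4) asks, uniformly on the sub-femto window
`L₀ ≤ L ≤ β^A`, that the swap-twisted zero-flux partition function falls a polynomial fraction short of the periodic one:
`β^{-k} Z(2L) ≤ Z(2L) − Z^S(2L)` (`Z = TT.physTrace`, `Z^S = TT.twistTrace`).  Its docstring names as FIRST RUNG (r1) the fixed-`L` instance
«`L = 1, 2`, `β → ∞` … provable by Laplace asymptotics».  This file proves the instance at EVERY fixed `L ≥ 2`:

* ★ `twistDeficit_rung_fixedL : ∀ L ≥ 2, ∃ k β₀, ∀ β ≥ β₀, β^{-k} Z(2L) ≤ Z(2L) − Z^S(2L)`.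

MECHANISM (variational, no precise asymptotics needed):
* §1 `physTrace_le_poly_mul_pow`: `Z(T) ≤ C_L β^{q_L} λ₀^T` (`T ≥ 2`, `β ≥ 1`; trace formula + Hilbert–Schmidt + the β-uniform floor, as in the
  K1a rung `ThermalTraceWindowFewBodyEntropyRungFixedL`);
* §2 ★ `physTrace_sub_twistTrace_ge`: for a swap-ODD physical `ψ ≠ 0`, `Z(2L) − Z^S(2L) ≥ 2 (q_β(ψ,ψ)/‖ψ‖²)^{2L}` — along ONE eigen-data
  (`TT.exists_eigenData`): `Z − Z^S = Σ_k λ_k^{2L}(1 − d_k)` (`traceFormula_all`, `eigenData_twistTrace`), `(∫ψe_k)² ≤ ½‖ψ‖²(1 − d_k)` for odd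
  `ψ` (`∫ψ(e_k∘S) = −∫ψe_k`, Cauchy–Schwarz against `e_k − e_k∘S`), `Σ_k λ_k(∫ψe_k)² = q_β(ψ,ψ)` (`eigenData_bilinear`, `n = 1`), Bessel
  `Σ_k(∫ψe_k)² ≤ ‖ψ‖²`, and the tangent-line Jensen inequality `Σλ^{2L}c ≥ (Σλc)^{2L}/(Σc)^{2L−1}` (`pow_tangent_le`);
* §3 the rung: `ψ = g − g∘S` with the sheet trial function `g` has Rayleigh quotient `≥ q_β(g,g) − q_β(g,g∘S) ≥ β^{−k}c_β^{|E|} ≥ β^{−k}λ₀`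
  (`sheetTrial_gap`, `topValue_le_latCE`), so `Z − Z^S ≥ 2β^{−2Lk}λ₀^{2L} ≥ (2/C_L) β^{−2Lk−q_L} Z(2L)`.

HONEST FRAMING: a finite-dimensional variational witness at each fixed `L` (constants `k_L`, `β₀(L)` blow up with `L`); NOT the crux (no
uniformity along `L ≤ β^A`), no semiclassics/RG, nothing about infinite volume or the continuum; K2a, R2ξ″ and the Clay Yang–Mills gap are
untouched.  No `sorry`, no new axiom, no new definition.  References: [cite: ReedSimonIV1978, Thm. XIII.1]; [cite: ReedSimonI1980, Thm. VI.22–VI.23];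
[cite: tHooft1979Flux]; [cite: MontvayMunster1994, (3.145)].
-/

set_option autoImplicit false

noncomputable section

open MeasureTheory Filter Topology Real Function
open Literature.MathematicalPhysics.QuantumLattice
open Literature.MathematicalPhysics.QuantumFieldTheory hiding SU2
open Summit.QuantumFields.YangMills.Theorems
open Summit.QuantumFields.YangMills.Theorems.FemtoTransferGap
open Summit.QuantumFields.YangMills.Theorems.FemtoTransferGap.FlatSheet
open scoped BigOperators

namespace Summit.QuantumFields.YangMills.Theorems.SwapTwistDeficit

/-! ## §1 The zero-flux thermal trace is polynomially close to `λ₀^T` at fixed lattice size -/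

/-- **`Z(T) ≤ C β^q λ₀^T` at fixed `L`** (`T ≥ 2`, `β ≥ 1`; `C = ((4/w₀)^{|E|}/c_L)²`, `q = 4|E|`): trace formula `Σ_k λ_k^T = Z(T)`,
`λ_k^T ≤ λ₀^{T−2}λ_k²`, Hilbert–Schmidt `Σλ_k² ≤ (sup K_β)²` and `sup K_β ≤ ((4/w₀)^{|E|}/c_L) β^{2|E|} λ₀`. [cite: ReedSimonI1980, Thm. VI.22]
[cite: MontvayMunster1994, (3.145)] -/
theorem physTrace_le_poly_mul_pow (L : ℕ) [NeZero L] {T : ℕ} (hT : 2 ≤ T) :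
    ∃ C q : ℝ, 0 < C ∧ ∀ β : ℝ, 1 ≤ β → TT.physTrace L β T ≤ C * β ^ q * levelValue su2Rep L β 0 ^ T := by
  set E : ℕ := Fintype.card (Edge 3 L) with hE
  set K : ℝ := (4 / (Real.exp (-(1 / 2 : ℝ)) * (8 / (3 * π ^ 3)))) ^ E / uniformFloorConst L with hK
  have hcL : 0 < uniformFloorConst L := uniformFloorConst_pos
  have hKpos : 0 < K := by positivity
  refine ⟨K ^ 2, ((4 * E : ℕ) : ℝ), by positivity, fun β hβ => ?_⟩
  have hβ0 : 0 < β := by linarith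
  rw [Real.rpow_natCast]
  set lam0 : ℝ := levelValue su2Rep L β 0 with hlam0
  have hl0 : 0 < lam0 := levelValue_zero_su2Rep_pos L β
  set M : ℝ := K * β ^ (2 * E) * lam0 with hM
  have hKM : ∀ U V : GaugeConfig 3 L FemtoTransferGap.SU2, transferKernel su2Rep β U V ≤ M := fun U V =>
    Summit.QuantumFields.YangMills.Theses.ThermalTraceWindow.transferKernel_le_poly_mul_levelValue_zero L hβ U V
  have hHS : ∀ k : ℕ, ∑ j ∈ Finset.range (k + 1), levelValue su2Rep L β j ^ 2 ≤ M ^ 2 := fun k => by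
    rw [Finset.sum_range]
    exact sum_levelValue_sq_le (L := L) hβ0 hKM k
  have hterm : ∀ k : ℕ, levelValue su2Rep L β k ^ T ≤ lam0 ^ (T - 2) * levelValue su2Rep L β k ^ 2 := fun k => by
    have hk0 : 0 ≤ levelValue su2Rep L β k := (levelValue_su2Rep_pos hβ0 k).le
    have hk : levelValue su2Rep L β k ≤ lam0 := levelValue_le_of_le hβ0 (Nat.zero_le k)
    have hsplit : levelValue su2Rep L β k ^ T = levelValue su2Rep L β k ^ (T - 2) * levelValue su2Rep L β k ^ 2 := by
      rw [← pow_add]; congr 1; omega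
    rw [hsplit]
    exact mul_le_mul_of_nonneg_right (pow_le_pow_left₀ hk0 hk _) (sq_nonneg _)
  have hS := TT.traceFormula_all L β T hβ hT
  have hbound : ∀ s : Finset ℕ, ∑ k ∈ s, levelValue su2Rep L β k ^ T ≤ lam0 ^ (T - 2) * M ^ 2 := fun s => by
    have hsub : s ⊆ Finset.range (s.sup id + 1) := fun i hi =>
      Finset.mem_range.2 (Nat.lt_succ_of_le (Finset.le_sup (f := id) hi))
    calc ∑ k ∈ s, levelValue su2Rep L β k ^ T ≤ ∑ k ∈ s, lam0 ^ (T - 2) * levelValue su2Rep L β k ^ 2 :=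
          Finset.sum_le_sum fun k _ => hterm k
      _ ≤ ∑ k ∈ Finset.range (s.sup id + 1), lam0 ^ (T - 2) * levelValue su2Rep L β k ^ 2 :=
          Finset.sum_le_sum_of_subset_of_nonneg hsub fun k _ _ => by positivity
      _ = lam0 ^ (T - 2) * ∑ k ∈ Finset.range (s.sup id + 1), levelValue su2Rep L β k ^ 2 := by rw [Finset.mul_sum]
      _ ≤ lam0 ^ (T - 2) * M ^ 2 := mul_le_mul_of_nonneg_left (hHS _) (pow_nonneg hl0.le _)
  have hZ : TT.physTrace L β T ≤ lam0 ^ (T - 2) * M ^ 2 := hasSum_le_of_sum_le hS hbound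
  have hfin : lam0 ^ (T - 2) * M ^ 2 = K ^ 2 * β ^ (4 * E) * lam0 ^ T := by
    rw [hM]
    have hT2 : T = (T - 2) + 2 := by omega
    conv_rhs => rw [hT2]
    rw [pow_add, show 4 * E = 2 * (2 * E) from by ring, pow_mul]
    ring
  exact hZ.trans_eq hfin

/-! ## §2 The swap-odd variational bound on the twist deficit -/

/-- **Odd overlaps are controlled by the swap defect**: for a swap-odd physical `ψ` and an `L²`-normalised physical `e`,
`2(∫ψe)² ≤ ‖ψ‖² · (1 − ∫ e·(e∘S))` (`∫ψ(e∘S) = −∫ψe`, so `2∫ψe = ⟨ψ, e − e∘S⟩`; Cauchy–Schwarz; `‖e − e∘S‖² = 2 − 2∫e(e∘S)`). [folklore] -/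
theorem two_mul_sq_integral_le_of_odd {L : ℕ} [NeZero L] {ψ e : GaugeConfig 3 L FemtoTransferGap.SU2 → ℝ} (hψ : IsPhys ψ) (he : IsPhys e)
    (hodd : ∀ U, ψ (configPerm (Equiv.swap (0 : Fin 3) 1) U) = -ψ U) (hnorm : l2 e e = 1) :
    2 * (∫ U, ψ U * e U ∂configMeasure FemtoTransferGap.SU2 L) ^ 2 ≤
      l2 ψ ψ * (1 - ∫ U, e U * e (configPerm (Equiv.swap (0 : Fin 3) 1) U) ∂configMeasure FemtoTransferGap.SU2 L) := by
  have heS : IsPhys (fun U => e (configPerm (Equiv.swap (0 : Fin 3) 1) U)) := he.comp_configPerm _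
  -- `∫ ψ (e∘S) = −∫ ψ e`
  have hflip : l2 ψ (fun U => e (configPerm (Equiv.swap (0 : Fin 3) 1) U)) = -l2 ψ e := by
    have hsum : ∫ U, (ψ U * e (configPerm (Equiv.swap (0 : Fin 3) 1) U) + ψ U * e U) ∂configMeasure FemtoTransferGap.SU2 L = 0 := by
      refine integral_eq_zero_of_swap_odd _ fun U => ?_
      rw [TT.configPerm_swap_swap, hodd]; ring
    rw [integral_add (hψ.integrable_mul heS) (hψ.integrable_mul he)] at hsum
    unfold l2; linarith
  -- `h = e − e∘S`
  have hh : IsPhys (e + (-1 : ℝ) • fun U => e (configPerm (Equiv.swap (0 : Fin 3) 1) U)) := he.add (heS.smul (-1))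
  have hl2h : l2 ψ (e + (-1 : ℝ) • fun U => e (configPerm (Equiv.swap (0 : Fin 3) 1) U)) = 2 * l2 ψ e := by
    rw [l2_comm, l2_add_left he (heS.smul (-1)) hψ, l2_smul_left, l2_comm e ψ, l2_comm _ ψ, hflip]; ring
  have hhh : l2 (e + (-1 : ℝ) • fun U => e (configPerm (Equiv.swap (0 : Fin 3) 1) U))
      (e + (-1 : ℝ) • fun U => e (configPerm (Equiv.swap (0 : Fin 3) 1) U)) =
      2 - 2 * ∫ U, e U * e (configPerm (Equiv.swap (0 : Fin 3) 1) U) ∂configMeasure FemtoTransferGap.SU2 L := by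
    have hSS : l2 (fun U => e (configPerm (Equiv.swap (0 : Fin 3) 1) U)) (fun U => e (configPerm (Equiv.swap (0 : Fin 3) 1) U)) = 1 := by
      rw [l2_comp_configPerm, hnorm]
    have hx : l2 (fun U => e (configPerm (Equiv.swap (0 : Fin 3) 1) U)) e = l2 e (fun U => e (configPerm (Equiv.swap (0 : Fin 3) 1) U)) :=
      l2_comm _ _
    rw [l2_add_left he (heS.smul (-1)) hh, l2_smul_left, l2_comm e, l2_comm (fun U => e (configPerm (Equiv.swap (0 : Fin 3) 1) U)),
      l2_add_left he (heS.smul (-1)) he, l2_add_left he (heS.smul (-1)) heS, l2_smul_left, l2_smul_left, hnorm, hSS, hx]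
    unfold l2; ring
  have hCS := sq_l2_le hψ hh
  rw [hl2h, hhh] at hCS
  unfold l2 at hCS ⊢
  nlinarith [hCS]

/-- ★ **Swap-odd variational bound on the twist deficit.**  For `L ≥ 2`, `β ≥ 1` and a swap-ODD physical test function `ψ` with `‖ψ‖² > 0`:
`2 · (q_β(ψ,ψ)/‖ψ‖²)^{2L} ≤ Z_phys(2L) − Z^S_phys(2L)`.  Along one eigen-data of the zero-flux transfer operator, `Z − Z^S = Σ_k λ_k^{2L}(1 − d_k)`
dominates `(2/‖ψ‖²) Σ_k λ_k^{2L} (∫ψe_k)²`, which by the tangent-line Jensen inequality with weights `(∫ψe_k)²` (total `≤ ‖ψ‖²`, Bessel) and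
first moment `Σ_k λ_k(∫ψe_k)² = q_β(ψ,ψ)` is `≥ 2 (q_β(ψ,ψ)/‖ψ‖²)^{2L}`. [cite: ReedSimonIV1978, Thm. XIII.1] [cite: ReedSimonI1980, Thm. VI.22–VI.23]
[cite: tHooft1979Flux] -/
theorem physTrace_sub_twistTrace_ge {L : ℕ} [NeZero L] (hL : 2 ≤ L) {β : ℝ} (hβ : 1 ≤ β)
    {ψ : GaugeConfig 3 L FemtoTransferGap.SU2 → ℝ} (hψ : IsPhys ψ) (hodd : ∀ U, ψ (configPerm (Equiv.swap (0 : Fin 3) 1) U) = -ψ U)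
    (hpos : 0 < l2 ψ ψ) :
    2 * (qform su2Rep β ψ ψ / l2 ψ ψ) ^ (2 * L) ≤ TT.physTrace L β (2 * L) - TT.twistTrace L β (2 * L) := by
  classical
  have hβ0 : 0 < β := by linarith
  set T : ℕ := 2 * L with hTdef
  have hT3 : 3 ≤ T := by omega
  have hT2 : 2 ≤ T := by omega
  obtain ⟨ι, _, b, lam, AP, emb, e, hAP, hsa, hbAP, -, hinj, hoff, hlam, hbe, he, hon, heig, -⟩ := TT.exists_eigenData (L := L) hβ0
  obtain ⟨M0, -, hM0⟩ := TT.exists_abs_transferKernel_le (L := L) β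
  obtain ⟨Cψ, hCψ⟩ := hψ.bounded
  have hψm := hψ.measurable
  have hψb : ∀ x, ‖ψ x‖ ≤ Cψ := fun x => by rw [Real.norm_eq_abs]; exact hCψ x
  set S := configPerm (G := FemtoTransferGap.SU2) (L := L) (Equiv.swap (0 : Fin 3) 1) with hS
  set n2 : ℝ := l2 ψ ψ with hn2
  set q : ℝ := qform su2Rep β ψ ψ with hq
  set c : ℕ → ℝ := fun k => (∫ U, ψ U * e k U ∂configMeasure FemtoTransferGap.SU2 L) ^ 2 with hc
  set d : ℕ → ℝ := fun k => ∫ U, e k U * e k (S U) ∂configMeasure FemtoTransferGap.SU2 L with hd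
  have hc0 : ∀ k, 0 ≤ c k := fun k => sq_nonneg _
  have hlam0 : ∀ k, 0 ≤ levelValue su2Rep L β k := fun k => (levelValue_su2Rep_pos hβ0 k).le
  -- (S1) Bessel: `Σ c ≤ ‖ψ‖²`
  obtain ⟨hc_sum, hc_le⟩ := TT.eigenData_bessel hinj hbe hψm hψb
  have hc_le' : ∑' k, c k ≤ n2 := by
    refine hc_le.trans (le_of_eq ?_)
    rw [hn2]; unfold l2
    exact integral_congr_ae (ae_of_all _ fun U => by ring)
  -- (S2) first moment: `Σ λ_k c_k = q`
  have h1 := TT.eigenData_bilinear hAP hsa hbAP hinj hoff hlam hbe hψm hψb hψm hψb (n := 1) le_rfl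
  have hval1 : ∫ U, ψ U * ((fun φ : GaugeConfig 3 L FemtoTransferGap.SU2 → ℝ => fun w =>
      ∫ z, TT.physKernel β w z * φ z ∂configMeasure FemtoTransferGap.SU2 L)^[1] ψ) U ∂configMeasure FemtoTransferGap.SU2 L = q := by
    rw [Function.iterate_one, hq, qform_eq_l2_transferApply]
    unfold l2
    refine integral_congr_ae (ae_of_all _ fun U => ?_)
    show ψ U * _ = ψ U * _
    rw [TT.integral_physKernel_mul_of_isPhys hM0 hψ U, transferApply_apply]
  rw [hval1] at h1
  have hq_sum : HasSum (fun k => levelValue su2Rep L β k * c k) q :=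
    h1.congr_fun fun k => by simp only [hc, pow_one]; ring
  -- (S2') `T`-th moment
  have hT1 : 1 ≤ T := by omega
  have hV := TT.eigenData_bilinear hAP hsa hbAP hinj hoff hlam hbe hψm hψb hψm hψb (n := T) hT1
  set V : ℝ := ∫ U, ψ U * ((fun φ : GaugeConfig 3 L FemtoTransferGap.SU2 → ℝ => fun w =>
      ∫ z, TT.physKernel β w z * φ z ∂configMeasure FemtoTransferGap.SU2 L)^[T] ψ) U ∂configMeasure FemtoTransferGap.SU2 L with hVdef
  have hV_sum : HasSum (fun k => levelValue su2Rep L β k ^ T * c k) V :=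
    hV.congr_fun fun k => by simp only [hc]; ring
  -- (S3)+(S4): `Z − Z^S = Σ λ^T (1 − d)`
  have htw := TT.eigenData_twistTrace hAP hbAP hinj hoff hlam hbe he heig hT3
  have htr := TT.traceFormula_all L β T hβ hT2
  have hdiff : HasSum (fun k => levelValue su2Rep L β k ^ T * (1 - d k)) (TT.physTrace L β T - TT.twistTrace L β T) :=
    (htr.sub htw).congr_fun fun k => by simp only [hd, hS]; ring
  -- (S5) termwise domination `(2/n2) λ^T c ≤ λ^T (1 − d)`
  have hterm : ∀ k, 2 * c k ≤ n2 * (1 - d k) := fun k =>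
    two_mul_sq_integral_le_of_odd hψ (he k) hodd (by simpa using hon k k)
  have hdom : ∀ k, 2 / n2 * (levelValue su2Rep L β k ^ T * c k) ≤ levelValue su2Rep L β k ^ T * (1 - d k) := by
    intro k
    have h := hterm k
    have hd1 : 2 / n2 * c k ≤ 1 - d k := by
      rw [div_mul_eq_mul_div, div_le_iff₀ hpos]; linarith
    calc 2 / n2 * (levelValue su2Rep L β k ^ T * c k) = levelValue su2Rep L β k ^ T * (2 / n2 * c k) := by ring
      _ ≤ levelValue su2Rep L β k ^ T * (1 - d k) := mul_le_mul_of_nonneg_left hd1 (pow_nonneg (hlam0 k) _)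
  have hstep1 : 2 / n2 * V ≤ TT.physTrace L β T - TT.twistTrace L β T :=
    hasSum_le hdom (hV_sum.mul_left (2 / n2)) hdiff
  -- (S7) tangent-line Jensen: `V ≥ q^T / n2^{T-1}`
  have hq0 : 0 ≤ q := by
    rw [hq]; exact qform_su2Rep_self_nonneg hβ0.le hψ
  have hstep2 : q ^ T / n2 ^ (T - 1) ≤ V := by
    set m : ℝ := ∑' k, c k with hm
    have hm_sum : HasSum c m := hc_sum.hasSum
    have hm0 : 0 ≤ m := hm_sum.nonneg hc0
    rcases hm0.eq_or_lt with hm00 | hmpos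
    · -- all weights vanish: `q = 0`, `V ≥ 0`
      have hck : ∀ k, c k = 0 := fun k =>
        le_antisymm ((le_hasSum hm_sum k fun j _ => hc0 j).trans (le_of_eq hm00.symm)) (hc0 k)
      have h0 : HasSum (fun k => levelValue su2Rep L β k * c k) 0 := by
        have : (fun k => levelValue su2Rep L β k * c k) = fun _ => 0 := funext fun k => by rw [hck k, mul_zero]
        rw [this]; exact hasSum_zero
      have hq00 : q = 0 := hq_sum.unique h0
      have hV0 : 0 ≤ V := hV_sum.nonneg fun k => mul_nonneg (pow_nonneg (hlam0 k) _) (hc0 k)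
      rw [hq00, zero_pow (by omega), zero_div]; exact hV0
    · set r : ℝ := q / m with hr
      have hr0 : 0 ≤ r := div_nonneg hq0 hmpos.le
      -- `Σ (r^T + T r^{T-1}(λ − r)) c = r^T m + T r^{T-1} (q − r m) = r^T m`
      have hlin : HasSum (fun k => (r ^ T + T * r ^ (T - 1) * (levelValue su2Rep L β k - r)) * c k) (r ^ T * m) := by
        have h := ((hm_sum.mul_left (r ^ T - T * r ^ (T - 1) * r)).add (hq_sum.mul_left (T * r ^ (T - 1))))
        have hval : (r ^ T - T * r ^ (T - 1) * r) * m + T * r ^ (T - 1) * q = r ^ T * m := by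
          have : q = r * m := by rw [hr]; field_simp
          rw [this]; ring
        rw [hval] at h
        exact h.congr_fun fun k => by ring
      have htan : r ^ T * m ≤ V :=
        hasSum_le (fun k => mul_le_mul_of_nonneg_right (SlowBitWindow.pow_tangent_le T (hlam0 k) hr0) (hc0 k)) hlin hV_sum
      -- `r^T m = q^T / m^{T-1} ≥ q^T / n2^{T-1}`
      have hmn : m ≤ n2 := hc_le'
      have hrm : q ^ T / n2 ^ (T - 1) ≤ r ^ T * m := by
        have hm0 : m ≠ 0 := hmpos.ne'
        have hmT : m ^ T = m ^ (T - 1) * m := by rw [← pow_succ]; congr 1; omega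
        have e1 : r ^ T * m = q ^ T / m ^ (T - 1) := by
          rw [hr, div_pow, hmT]
          field_simp
        rw [e1]
        exact div_le_div_of_nonneg_left (pow_nonneg hq0 _) (pow_pos hmpos _) (pow_le_pow_left₀ hmpos.le hmn _)
      exact hrm.trans htan
  -- assemble: `2 (q/n2)^T = (2/n2) · q^T/n2^{T-1}`
  have hfin : 2 * (q / n2) ^ T = 2 / n2 * (q ^ T / n2 ^ (T - 1)) := by
    have hn0 : n2 ≠ 0 := hpos.ne'
    have hnT : n2 ^ T = n2 ^ (T - 1) * n2 := by rw [← pow_succ]; congr 1; omega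
    rw [div_pow, hnT]
    field_simp
  rw [hfin]
  exact (mul_le_mul_of_nonneg_left hstep2 (by positivity)).trans hstep1

/-! ## §3 The rung -/

/-- ★ **`TwistDeficit` at every fixed lattice size `L ≥ 2`** (rung r1 of item stmt-QuantumFields-23317, for all `L`): there are `k, β₀` with
`β^{-k} Z_phys(2L) ≤ Z_phys(2L) − Z^S_phys(2L)` for all `β ≥ β₀` — the swap-odd sector of the zero-flux transfer operator of `SU(2)` on `(ℤ/L)³`
carries at least a `β`-power fraction of the thermal weight at temperature `1/(2L)`.  (Odd trial function `g − g∘S` from the sheet trial function: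
Rayleigh quotient `≥ β^{−k}λ₀` by `sheetTrial_gap`; §2; and `Z(2L) ≤ Cβ^qλ₀^{2L}` by §1.) [cite: ReedSimonIV1978, Thm. XIII.1] [cite: tHooft1979Flux] -/
theorem twistDeficit_rung_fixedL (L : ℕ) [NeZero L] (hL : 2 ≤ L) :
    ∃ k β₀ : ℝ, ∀ β : ℝ, β₀ ≤ β →
      β ^ (-k) * TT.physTrace L β (2 * L) ≤ TT.physTrace L β (2 * L) - TT.twistTrace L β (2 * L) := by
  obtain ⟨k, β₁, hβ₁, hgap⟩ := sheetTrial_gap L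
  obtain ⟨C, q, hC, hZ⟩ := physTrace_le_poly_mul_pow L (T := 2 * L) (by omega)
  refine ⟨2 * L * k + q + 1, max β₁ (C / 2), fun β hβ => ?_⟩
  have hββ₁ : β₁ ≤ β := (le_max_left _ _).trans hβ
  have hβC : C / 2 ≤ β := (le_max_right _ _).trans hβ
  have hβ1 : 1 ≤ β := hβ₁.trans hββ₁
  have hβ0 : 0 < β := by linarith
  -- the odd trial function `ψ = g − g∘S`
  set S := configPerm (G := FemtoTransferGap.SU2) (L := L) (Equiv.swap (0 : Fin 3) 1) with hS
  set g : GaugeConfig 3 L FemtoTransferGap.SU2 → ℝ := sheetTrial with hg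
  set gS : GaugeConfig 3 L FemtoTransferGap.SU2 → ℝ := fun U => sheetTrial (S U) with hgS
  have hgP : IsPhys g := isPhys_sheetTrial
  have hgSP : IsPhys gS := isPhys_sheetTrial.comp_configPerm (Equiv.swap (0 : Fin 3) 1)
  set ψ : GaugeConfig 3 L FemtoTransferGap.SU2 → ℝ := g + (-1 : ℝ) • gS with hψdef
  have hψ : IsPhys ψ := hgP.add (hgSP.smul (-1))
  have hodd : ∀ U, ψ (S U) = -ψ U := fun U => by
    simp only [hψdef, hg, hgS, hS, Pi.add_apply, Pi.smul_apply, smul_eq_mul, TT.configPerm_swap_swap]; ring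
  set n : ℝ := l2 g g with hn
  set Q : ℝ := qform su2Rep β g g with hQ
  set X : ℝ := qform su2Rep β g gS with hX
  have hn0 : 0 < n := l2_sheetTrial_pos
  have hn1 : n ≤ 1 := l2_sheetTrial_le_one
  have hnS : l2 gS gS = n := l2_sheetTrial_swap
  have hcross : l2 g gS = 0 := l2_sheetTrial_cross
  have hcross' : l2 gS g = 0 := by rw [l2_comm, hcross]
  have hQS : qform su2Rep β gS gS = Q := qform_sheetTrial_swap_swap β
  have hXS : qform su2Rep β gS g = X := qform_sheetTrial_swap_comm β
  have hl2ψ : l2 ψ ψ = 2 * n := by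
    rw [hψdef, l2_add_left hgP (hgSP.smul (-1)) hψ, l2_smul_left, l2_comm g, l2_comm gS,
      l2_add_left hgP (hgSP.smul (-1)) hgP, l2_add_left hgP (hgSP.smul (-1)) hgSP, l2_smul_left, l2_smul_left, hnS, hcross, hcross']
    ring
  have hqψ : qform su2Rep β ψ ψ = 2 * (Q - X) := by
    rw [hψdef, qform_add_left β hgP (hgSP.smul (-1)) hψ, qform_smul_left,
      qform_su2Rep_comm β hgP hψ, qform_su2Rep_comm β hgSP hψ,
      qform_add_left β hgP (hgSP.smul (-1)) hgP, qform_add_left β hgP (hgSP.smul (-1)) hgSP,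
      qform_smul_left, qform_smul_left, hQS, hXS, ← hQ, ← hX]
    ring
  have hpos : 0 < l2 ψ ψ := by rw [hl2ψ]; linarith
  -- Rayleigh quotient `≥ s = β^{-k} λ₀`
  set s : ℝ := β ^ (-k) * levelValue su2Rep L β 0 with hs
  have hlam0 : 0 < levelValue su2Rep L β 0 := levelValue_zero_su2Rep_pos L β
  have hs0 : 0 ≤ s := mul_nonneg (Real.rpow_nonneg hβ0.le _) hlam0.le
  have hsR : s ≤ qform su2Rep β ψ ψ / l2 ψ ψ := by
    rw [hqψ, hl2ψ, le_div_iff₀ (by linarith)]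
    have h1 : s ≤ β ^ (-k) * latCE L β :=
      mul_le_mul_of_nonneg_left (by rw [levelValue_zero]; exact topValue_le_latCE hβ0.le) (Real.rpow_nonneg hβ0.le _)
    have h2 : β ^ (-k) * latCE L β ≤ Q - X := hgap β hββ₁
    nlinarith [h1.trans h2]
  -- §2 and §1
  have hvar := physTrace_sub_twistTrace_ge hL hβ1 hψ hodd hpos
  have hZβ := hZ β hβ1
  have hpow : s ^ (2 * L) ≤ (qform su2Rep β ψ ψ / l2 ψ ψ) ^ (2 * L) := pow_le_pow_left₀ hs0 hsR _
  -- `s^{2L} = β^{-2Lk} λ₀^{2L}`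
  have hs_pow : s ^ (2 * L) = β ^ (-(2 * L * k)) * levelValue su2Rep L β 0 ^ (2 * L) := by
    rw [hs, mul_pow, ← Real.rpow_natCast (β ^ (-k)) (2 * L), ← Real.rpow_mul hβ0.le]
    congr 2; push_cast; ring
  -- `β^{-(2Lk+q+1)} Z ≤ 2 β^{-2Lk} λ₀^{2L}`
  have hmain : β ^ (-(2 * L * k + q + 1)) * TT.physTrace L β (2 * L) ≤ 2 * s ^ (2 * L) := by
    rw [hs_pow]
    have hZ0 : 0 ≤ TT.physTrace L β (2 * L) := by
      have := (TT.traceFormula_all L β (2 * L) hβ1 (by omega)).nonneg fun k => pow_nonneg (levelValue_su2Rep_pos hβ0 k).le _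
      exact this
    have e1 : β ^ (-(2 * L * k + q + 1)) = β ^ (-(2 * L * k)) * (β ^ q)⁻¹ * β⁻¹ := by
      rw [show -(2 * L * k + q + 1) = -(2 * L * k) + (-q) + (-1 : ℝ) by ring, Real.rpow_add hβ0, Real.rpow_add hβ0,
        Real.rpow_neg hβ0.le q, Real.rpow_neg_one]
    rw [e1]
    have hβinv : β⁻¹ ≤ 2 / C := by
      rw [inv_le_comm₀ hβ0 (by positivity), inv_div]; exact hβC
    calc β ^ (-(2 * L * k)) * (β ^ q)⁻¹ * β⁻¹ * TT.physTrace L β (2 * L)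
        ≤ β ^ (-(2 * L * k)) * (β ^ q)⁻¹ * (2 / C) * (C * β ^ q * levelValue su2Rep L β 0 ^ (2 * L)) := by
          refine mul_le_mul (mul_le_mul_of_nonneg_left hβinv (by positivity)) hZβ hZ0 (by positivity)
      _ = 2 * (β ^ (-(2 * L * k)) * levelValue su2Rep L β 0 ^ (2 * L)) := by
          have hq0 : β ^ q ≠ 0 := (Real.rpow_pos_of_pos hβ0 q).ne'
          field_simp
  calc β ^ (-(2 * L * k + q + 1)) * TT.physTrace L β (2 * L) ≤ 2 * s ^ (2 * L) := hmain
    _ ≤ 2 * (qform su2Rep β ψ ψ / l2 ψ ψ) ^ (2 * L) := by linarith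
    _ ≤ TT.physTrace L β (2 * L) - TT.twistTrace L β (2 * L) := hvar

/-- The rung is literally the fixed-`L` slice of `TwistDeficit`'s conclusion (same shape, the window hypotheses unused). -/
theorem twistDeficit_rung_fixedL_shape (L : ℕ) [NeZero L] (hL : 2 ≤ L) :
    ∃ k β₀ : ℝ, ∀ β : ℝ, β₀ ≤ β → ∀ A : ℝ, 0 < A → ((L : ℕ) : ℝ) ≤ β ^ A →
      β ^ (-k) * TT.physTrace L β (2 * L) ≤ TT.physTrace L β (2 * L) - TT.twistTrace L β (2 * L) := by
  obtain ⟨k, β₀, h⟩ := twistDeficit_rung_fixedL L hL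
  exact ⟨k, β₀, fun β hβ _ _ _ => h β hβ⟩

end Summit.QuantumFields.YangMills.Theorems.SwapTwistDeficit

end
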